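import Mathlib
import Summits.Ventures.PercRepro2.MixChord
import Summits.Ventures.PercRepro2.OneEdge

/-!
# (MIX-CHORD) along the internal and the bridge root edges — with equality (blind cell PercRepro2,
night-1 g19; proofs/NIGHT1-G19.md §2)

The root edges of `Chord.rootEdges` are the fractional edges touching `S_l ∪ S_h` (the weight-`1`
clusters of the roots).  Two classes are closed here for the row `Mix.MixChord` of `MixChord.lean`:

* **internal** (`mixChord_internal`): both ends in the same weight-`1` cluster — on the support of
  `p` the ends are already joined, so opening or closing `e` changes no connection
  (`conn_update_true_iff_of_internal`, from `OneEdge.conn_update_true_iff`); every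
  connection-determined event (`ConnDet`) has the same probability under `p`, `p[e ↦ 1]`,
  `p[e ↦ 0]` (the support coupling `prob_update_one_eq_prob_update_zero_of_iff_support`), and the
  mixed chord is an equality;
* **bridge** (`mixChord_bridge`): one end in `S_l`, the other in `S_h` — with `e` open the roots are
  joined, so every sub-event of `Q` is null under `p[e ↦ 1]` and is `(1 − p_e)` times its
  `p[e ↦ 0]`-probability under `p` (`prob_eq_of_bridge`); `Gc`, a cubic form in the `Q`-masses
  (`Gc_eq_of_scale`: `Gc p = c³ · Gc p'` when every connection-determined sub-event of `Q` scales
  by `c`), is `(1 − p_e)³ Gc (p[e ↦ 0])`, `D · Z` is `(1 − p_e)²` times its closed value, and the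
  mixed chord is again an equality.

Own code; standard axioms.
-/

namespace Summit.Ventures.PercRepro2

open UnionCluster CovForm

namespace Mix

open scoped Classical

/-! ## The support of a weight vector and the weight-`1` clusters -/

section Support

variable {V : Type*} {E : Type*} [Fintype E] [DecidableEq E] {R : Type*} [Field R]
  [LinearOrder R] [IsStrictOrderedRing R]

omit [DecidableEq E] in
/-- On the support of `p` every weight-`1` edge is open: `oneConfig p ≤ ω`. -/
lemma oneConfig_le_of_weight_ne_zero {p : E → R} {ω : Config E} (hω : weight p ω ≠ 0) :
    Chord.oneConfig p ≤ ω := by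
  intro e
  by_cases h1 : p e = 1
  · have hnf : e ∉ Chord.frac p := by
      rw [Chord.mem_frac]
      exact fun h => h.2 h1
    rw [Chord.support_eq_oneConfig hω hnf]
  · have : Chord.oneConfig p e = false := by simp [Chord.oneConfig, h1]
    rw [this]
    exact Bool.false_le _

omit [DecidableEq E] in
/-- The weight-`1` cluster of `v` is inside the cluster of `v` on the support. -/
lemma conn_of_mem_oneCluster {p : E → R} {ω : Config E} (hω : weight p ω ≠ 0)
    {ends : E → Sym2 V} {v x : V} (hx : x ∈ cluster ends (Chord.oneConfig p) v) :
    Conn ends ω v x :=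
  conn_mono (oneConfig_le_of_weight_ne_zero hω) (mem_cluster.1 hx)

/-- Pinning `e` open: the support of `p[e ↦ 1]` has `e` open. -/
lemma eq_true_of_weight_update_one_ne_zero {p : E → R} {ω : Config E} {e : E}
    (hω : weight (Function.update p e 1) ω ≠ 0) : ω e = true := by
  have hnf : e ∉ Chord.frac (Function.update p e 1) := by
    rw [Chord.mem_frac]
    simp
  rw [Chord.support_eq_oneConfig hω hnf]
  simp [Chord.oneConfig]

omit [Fintype E] [IsStrictOrderedRing R] in
/-- `oneConfig p ≤ oneConfig (p[e ↦ 1])`. -/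
lemma oneConfig_le_update_one (p : E → R) (e : E) :
    Chord.oneConfig p ≤ Chord.oneConfig (Function.update p e 1) := by
  intro e'
  by_cases h : e' = e
  · subst h
    simp [Chord.oneConfig]
  · simp [Chord.oneConfig, Function.update_of_ne h]

/-- `oneConfig p ≤ ω[e ↦ closed]` for a fractional `e` on the support of `p`. -/
lemma oneConfig_le_update_false {p : E → R} {ω : Config E} (hω : weight p ω ≠ 0) {e : E}
    (he : e ∈ Chord.frac p) : Chord.oneConfig p ≤ Function.update ω e false := by
  intro e'
  by_cases h : e' = e
  · subst h
    simp [Chord.oneConfig, (Chord.mem_frac.1 he).2]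
  · rw [Function.update_of_ne h]
    exact oneConfig_le_of_weight_ne_zero hω e'

end Support

/-! ## Connection-determined events -/

section ConnDet

variable {V : Type*} {E : Type*}

/-- An event is *connection-determined* if it only depends on the connection relation. -/
def ConnDet (ends : E → Sym2 V) (X : Set (Config E)) : Prop :=
  ∀ ω ω' : Config E, (∀ u v, Conn ends ω u v ↔ Conn ends ω' u v) → (ω ∈ X ↔ ω' ∈ X)

variable {ends : E → Sym2 V}

/-- Connection-determined events are closed under intersection. -/
lemma ConnDet.inter {A B : Set (Config E)} (hA : ConnDet ends A) (hB : ConnDet ends B) :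
    ConnDet ends (A ∩ B) :=
  fun ω ω' h => by rw [Set.mem_inter_iff, Set.mem_inter_iff, hA ω ω' h, hB ω ω' h]

/-- Connection-determined events are closed under complement. -/
lemma ConnDet.compl {A : Set (Config E)} (hA : ConnDet ends A) : ConnDet ends Aᶜ :=
  fun ω ω' h => by rw [Set.mem_compl_iff, Set.mem_compl_iff, hA ω ω' h]

/-- Connection-determined events are closed under union. -/
lemma ConnDet.union {A B : Set (Config E)} (hA : ConnDet ends A) (hB : ConnDet ends B) :
    ConnDet ends (A ∪ B) :=
  fun ω ω' h => by rw [Set.mem_union, Set.mem_union, hA ω ω' h, hB ω ω' h]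

/-- `{u ↔ v}` is connection-determined. -/
lemma connDet_connEvent (u v : V) : ConnDet ends (connEvent ends u v) :=
  fun ω ω' h => by simp only [mem_connEvent, h u v]

/-- `{s ↮ X}` is connection-determined. -/
lemma connDet_avoidAll (s : V) (X : Finset V) : ConnDet ends (avoidAll ends s X) :=
  fun ω ω' h => by simp only [avoidAll, Set.mem_setOf_eq, h s]

/-- `PD` is connection-determined. -/
lemma connDet_PDEvent (a₁ a₂ a₃ : V) : ConnDet ends (PDEvent ends a₁ a₂ a₃) :=
  (connDet_connEvent a₁ a₂).compl.inter
    ((connDet_connEvent a₃ a₁).union (connDet_connEvent a₃ a₂)).compl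

/-- `T` is connection-determined. -/
lemma connDet_TEvent (a₁ a₂ a₃ : V) : ConnDet ends (TEvent ends a₁ a₂ a₃) :=
  (connDet_connEvent a₂ a₁).compl.inter (connDet_connEvent a₂ a₃)

end ConnDet

/-! ## `Gc` under a uniform scaling of the `Q`-masses -/

section Scale

variable {V : Type*} {E : Type*} [Fintype E] [DecidableEq E] {R : Type*} [Field R]
  [LinearOrder R] [IsStrictOrderedRing R]

omit [Fintype E] [DecidableEq E] [IsStrictOrderedRing R] in
/-- `T ⊆ Q`. -/
lemma TEvent_subset_Q (ends : E → Sym2 V) (a₁ a₂ a₃ : V) :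
    TEvent ends a₁ a₂ a₃ ⊆ avoidAll ends a₂ {a₁} := fun ω hω => by
  simp only [avoidAll, Set.mem_setOf_eq, Finset.mem_singleton, forall_eq]
  exact hω.1

omit [Fintype E] [DecidableEq E] [IsStrictOrderedRing R] in
/-- `T′ ⊆ Q`. -/
lemma TEvent_swap_subset_Q (ends : E → Sym2 V) (a₁ a₂ a₃ : V) :
    TEvent ends a₂ a₁ a₃ ⊆ avoidAll ends a₂ {a₁} := fun ω hω => by
  simp only [avoidAll, Set.mem_setOf_eq, Finset.mem_singleton, forall_eq]
  exact fun h => hω.1 (conn_symm h)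

/-- **`Gc` is a cubic form in the connection-determined `Q`-masses**: if every such mass scales by
`c` from `p'` to `p`, then `Gc p = c³ · Gc p'`. -/
theorem Gc_eq_of_scale (p p' : E → R) (ends : E → Sym2 V) (o a₁ a₂ a₃ b : V) (c : R)
    (h : ∀ X : Set (Config E), ConnDet ends X → X ⊆ avoidAll ends a₂ {a₁} →
      prob p X = c * prob p' X) :
    Gc p ends o a₁ a₂ a₃ b = c ^ 3 * Gc p' ends o a₁ a₂ a₃ b := by
  have hQs : avoidAll ends a₂ {a₁} ⊆ avoidAll ends a₂ {a₁} := le_rfl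
  have hPDs := Chord.PDEvent_subset_avoidAll ends a₁ a₂ a₃
  have hTs := TEvent_subset_Q ends a₁ a₂ a₃
  have hT's := TEvent_swap_subset_Q ends a₁ a₂ a₃
  have hi : ∀ (A X : Set (Config E)), A ⊆ avoidAll ends a₂ {a₁} →
      A ∩ X ⊆ avoidAll ends a₂ {a₁} := fun A X hA => Set.inter_subset_left.trans hA
  have hQ := connDet_avoidAll (ends := ends) a₂ ({a₁} : Finset V)
  have hPD := connDet_PDEvent (ends := ends) a₁ a₂ a₃
  have hT := connDet_TEvent (ends := ends) a₁ a₂ a₃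
  have hT' := connDet_TEvent (ends := ends) a₂ a₁ a₃
  have hc := connDet_connEvent (ends := ends)
  unfold Gc DEF EQbo EQb3 EQb3o EQo EQ3 EQ3o PDb PDbo Do
  rw [gap_eq_Q p, gap_eq_Q p']
  simp only [h _ hQ hQs, h _ hPD hPDs, h _ hT hTs, h _ hT' hT's,
    h _ (hQ.inter (hc _ _)) (hi _ _ hQs), h _ (hQ.inter ((hc _ _).inter (hc _ _))) (hi _ _ hQs),
    h _ (hPD.inter (hc _ _)) (hi _ _ hPDs), h _ (hPD.inter ((hc _ _).inter (hc _ _))) (hi _ _ hPDs),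
    h _ (hT.inter (hc _ _)) (hi _ _ hTs), h _ (hT.inter ((hc _ _).inter (hc _ _))) (hi _ _ hTs),
    h _ (hT'.inter (hc _ _)) (hi _ _ hT's), h _ (hT'.inter ((hc _ _).inter (hc _ _))) (hi _ _ hT's)]
  ring

end Scale

/-! ## The bridge edges: a fractional edge from `S_l` to `S_h` — the chord holds with equality -/

section Bridge

variable {V : Type*} {E : Type*} [Fintype E] [DecidableEq E] {R : Type*} [Field R]
  [LinearOrder R] [IsStrictOrderedRing R]

variable (p : E → R) (ends : E → Sym2 V) {a₁ a₂ : V} {e : E} {x y : V}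

/-- Pinning a bridge edge open joins the roots: every sub-event of `Q` is null under `p[e ↦ 1]`. -/
lemma prob_update_one_eq_zero_of_bridge (hx : x ∈ cluster ends (Chord.oneConfig p) a₁)
    (hy : y ∈ cluster ends (Chord.oneConfig p) a₂) (he : ends e = s(x, y))
    (X : Set (Config E)) (hX : X ⊆ avoidAll ends a₂ {a₁}) :
    prob (Function.update p e 1) X = 0 := by
  unfold prob
  refine Finset.sum_eq_zero fun ω _ => ?_
  by_cases hω : weight (Function.update p e 1) ω = 0
  · by_cases hmem : ω ∈ X
    · rw [Set.indicator_of_mem hmem, hω]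
    · rw [Set.indicator_of_notMem hmem]
  · rw [Set.indicator_of_notMem]
    intro hωX
    have hQ : ¬ Conn ends ω a₂ a₁ := hX hωX a₁ (Finset.mem_singleton_self a₁)
    have hωe : ω e = true := eq_true_of_weight_update_one_ne_zero hω
    have hle : Chord.oneConfig p ≤ ω :=
      (oneConfig_le_update_one p e).trans (oneConfig_le_of_weight_ne_zero hω)
    have h1x : Conn ends ω a₁ x := conn_mono hle (mem_cluster.1 hx)
    have h2y : Conn ends ω a₂ y := conn_mono hle (mem_cluster.1 hy)
    have hxy : Conn ends ω x y := conn_of_openAdj ⟨e, hωe, he⟩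
    exact hQ (conn_trans h2y (conn_trans (conn_symm hxy) (conn_symm h1x)))

/-- Along a bridge edge every sub-event of `Q` has `P_p = (1 − p_e) · P_{p[e ↦ 0]}`. -/
lemma prob_eq_of_bridge (hx : x ∈ cluster ends (Chord.oneConfig p) a₁)
    (hy : y ∈ cluster ends (Chord.oneConfig p) a₂) (he : ends e = s(x, y))
    (X : Set (Config E)) (hX : X ⊆ avoidAll ends a₂ {a₁}) :
    prob p X = (1 - p e) * prob (Function.update p e 0) X := by
  rw [prob_eq_pin p X e, prob_update_one_eq_zero_of_bridge p ends hx hy he X hX, mul_zero,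
    zero_add]

/-- **(MIX-CHORD) along a bridge edge, with equality**: `Gc = (1 − q)³ Gc⁰`, `D·Z = (1 − q)² D⁰Z⁰`
and `Gc (p[e ↦ 1]) = 0`. -/
theorem mixChord_bridge (hp : IsProbVec p) (hx : x ∈ cluster ends (Chord.oneConfig p) a₁)
    (hy : y ∈ cluster ends (Chord.oneConfig p) a₂) (he : ends e = s(x, y)) (o a₃ b : V) :
    p e * Gc (Function.update p e 1) ends o a₁ a₂ a₃ b +
      (1 - p e) * (shrink p ends a₁ a₂ a₃ e * Gc (Function.update p e 0) ends o a₁ a₂ a₃ b) ≤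
        Gc p ends o a₁ a₂ a₃ b := by
  have hp0 : IsProbVec (Function.update p e 0) := hp.update e le_rfl zero_le_one
  have hp1 : IsProbVec (Function.update p e 1) := hp.update e zero_le_one le_rfl
  have hZ1 : prob (Function.update p e 1) (avoidAll ends a₂ {a₁}) = 0 :=
    prob_update_one_eq_zero_of_bridge p ends hx hy he _ le_rfl
  have hG1 : Gc (Function.update p e 1) ends o a₁ a₂ a₃ b = 0 :=
    Chord.Gc_eq_zero_of_degenerate hp1 ends o a₁ a₂ a₃ b (by rw [hZ1, mul_zero])
  have hG : Gc p ends o a₁ a₂ a₃ b = (1 - p e) ^ 3 * Gc (Function.update p e 0) ends o a₁ a₂ a₃ b :=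
    Gc_eq_of_scale p (Function.update p e 0) ends o a₁ a₂ a₃ b (1 - p e)
      fun X _ hX => prob_eq_of_bridge p ends hx hy he X hX
  have hD := prob_eq_of_bridge p ends hx hy he _ (Chord.PDEvent_subset_avoidAll ends a₁ a₂ a₃)
  have hZ := prob_eq_of_bridge p ends hx hy he (avoidAll ends a₂ {a₁}) le_rfl
  rw [hG1, mul_zero, zero_add, hG]
  unfold shrink
  rw [hD, hZ]
  by_cases hden : prob (Function.update p e 0) (PDEvent ends a₁ a₂ a₃) *
      prob (Function.update p e 0) (avoidAll ends a₂ {a₁}) = 0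
  · rw [Chord.Gc_eq_zero_of_degenerate hp0 ends o a₁ a₂ a₃ b hden]
    simp
  · obtain ⟨hD0, hZ0⟩ := mul_ne_zero_iff.1 hden
    have : (1 - p e) * prob (Function.update p e 0) (PDEvent ends a₁ a₂ a₃) *
        ((1 - p e) * prob (Function.update p e 0) (avoidAll ends a₂ {a₁})) /
        (prob (Function.update p e 0) (PDEvent ends a₁ a₂ a₃) *
          prob (Function.update p e 0) (avoidAll ends a₂ {a₁})) = (1 - p e) ^ 2 := by
      field_simp
    rw [this]
    exact le_of_eq (by ring)

end Bridge

/-! ## The internal edges: a fractional edge inside `S_l` (or inside `S_h`) — equality -/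

section Internal

variable {V : Type*} {E : Type*} [Fintype E] [DecidableEq E] {R : Type*} [Field R]
  [LinearOrder R] [IsStrictOrderedRing R]

variable (p : E → R) {ends : E → Sym2 V} {e : E} {x y : V}

omit [LinearOrder R] [IsStrictOrderedRing R] in
/-- The coupling of `p[e ↦ 1]` and `p[e ↦ 0]` on the support of `p`: events matched configuration
by configuration ON THE SUPPORT have the same probability. -/
lemma prob_update_one_eq_prob_update_zero_of_iff_support (A B : Set (Config E))
    (h : ∀ ω, weight p ω ≠ 0 →
      (Function.update ω e true ∈ A ↔ Function.update ω e false ∈ B)) :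
    prob (Function.update p e 1) A = prob (Function.update p e 0) B := by
  rw [prob_eq_expect_indicator, prob_eq_expect_indicator, expect_update_one, expect_update_zero]
  unfold expect
  refine Finset.sum_congr rfl fun ω _ => ?_
  by_cases hω : weight p ω = 0
  · rw [hω, zero_mul, zero_mul]
  · congr 1
    dsimp only
    by_cases hA : Function.update ω e true ∈ A
    · simp only [Set.indicator_of_mem hA, Set.indicator_of_mem ((h ω hω).1 hA), Pi.one_apply]
    · rw [Set.indicator_of_notMem hA, Set.indicator_of_notMem (fun hB => hA ((h ω hω).2 hB))]

/-- Opening a fractional edge whose ends are joined by weight-`1` edges changes no connection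
(on the support of `p`). -/
lemma conn_update_true_iff_of_internal {ω : Config E} (hω : weight p ω ≠ 0)
    (hfrac : e ∈ Chord.frac p) {v : V} (hx : x ∈ cluster ends (Chord.oneConfig p) v)
    (hy : y ∈ cluster ends (Chord.oneConfig p) v) (he : ends e = s(x, y)) (s t : V) :
    Conn ends (Function.update ω e true) s t ↔ Conn ends (Function.update ω e false) s t := by
  have hle := oneConfig_le_update_false hω hfrac
  have hxy : Conn ends (Function.update ω e false) x y :=
    conn_trans (conn_symm (conn_mono hle (mem_cluster.1 hx))) (conn_mono hle (mem_cluster.1 hy))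
  constructor
  · intro h
    have hup : Function.update ω e true = Function.update (Function.update ω e false) e true := by
      rw [Function.update_idem]
    rw [hup, OneEdge.conn_update_true_iff he] at h
    rcases h with h | ⟨h1, h2⟩ | ⟨h1, h2⟩
    · exact h
    · exact conn_trans h1 (conn_trans hxy h2)
    · exact conn_trans h1 (conn_trans (conn_symm hxy) h2)
  · intro h
    refine conn_mono ?_ h
    intro e'
    by_cases h' : e' = e
    · subst h'
      simp
    · rw [Function.update_of_ne h', Function.update_of_ne h']

/-- Along an internal edge every connection-determined event has the same probability under
`p[e ↦ 1]`, `p[e ↦ 0]` and `p`. -/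
lemma prob_eq_of_internal (hfrac : e ∈ Chord.frac p) {v : V}
    (hx : x ∈ cluster ends (Chord.oneConfig p) v) (hy : y ∈ cluster ends (Chord.oneConfig p) v)
    (he : ends e = s(x, y)) (X : Set (Config E)) (hX : ConnDet ends X) :
    prob (Function.update p e 1) X = prob (Function.update p e 0) X ∧
      prob p X = prob (Function.update p e 0) X := by
  have h1 : prob (Function.update p e 1) X = prob (Function.update p e 0) X :=
    prob_update_one_eq_prob_update_zero_of_iff_support p X X fun ω hω =>
      hX _ _ (conn_update_true_iff_of_internal p hω hfrac hx hy he)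
  refine ⟨h1, ?_⟩
  rw [prob_eq_pin p X e, h1]
  ring

/-- **(MIX-CHORD) along an internal edge, with equality**: nothing moves. -/
theorem mixChord_internal (hp : IsProbVec p) (hfrac : e ∈ Chord.frac p) {v : V}
    (hx : x ∈ cluster ends (Chord.oneConfig p) v) (hy : y ∈ cluster ends (Chord.oneConfig p) v)
    (he : ends e = s(x, y)) (o a₁ a₂ a₃ b : V) :
    p e * Gc (Function.update p e 1) ends o a₁ a₂ a₃ b +
      (1 - p e) * (shrink p ends a₁ a₂ a₃ e * Gc (Function.update p e 0) ends o a₁ a₂ a₃ b) ≤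
        Gc p ends o a₁ a₂ a₃ b := by
  have hp0 : IsProbVec (Function.update p e 0) := hp.update e le_rfl zero_le_one
  have hG1 : Gc (Function.update p e 1) ends o a₁ a₂ a₃ b =
      Gc (Function.update p e 0) ends o a₁ a₂ a₃ b := by
    have := Gc_eq_of_scale (Function.update p e 1) (Function.update p e 0) ends o a₁ a₂ a₃ b 1
      fun X hX _ => by rw [(prob_eq_of_internal p hfrac hx hy he X hX).1, one_mul]
    rw [this, one_pow, one_mul]
  have hG : Gc p ends o a₁ a₂ a₃ b = Gc (Function.update p e 0) ends o a₁ a₂ a₃ b := by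
    have := Gc_eq_of_scale p (Function.update p e 0) ends o a₁ a₂ a₃ b 1
      fun X hX _ => by rw [(prob_eq_of_internal p hfrac hx hy he X hX).2, one_mul]
    rw [this, one_pow, one_mul]
  have hD := (prob_eq_of_internal p hfrac hx hy he _ (connDet_PDEvent a₁ a₂ a₃)).2
  have hZ := (prob_eq_of_internal p hfrac hx hy he _ (connDet_avoidAll a₂ {a₁})).2
  rw [hG1, hG]
  unfold shrink
  rw [hD, hZ]
  by_cases hden : prob (Function.update p e 0) (PDEvent ends a₁ a₂ a₃) *
      prob (Function.update p e 0) (avoidAll ends a₂ {a₁}) = 0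
  · rw [Chord.Gc_eq_zero_of_degenerate hp0 ends o a₁ a₂ a₃ b hden]
    simp
  · rw [div_self hden]
    exact le_of_eq (by ring)

end Internal

end Mix

end Summit.Ventures.PercRepro2
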